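import Summits.PneNP.PneNP.Theses.PermanentDescent
import Literature.Computability.Complexity.Transducers
import HarnessLib

/-!
# Crux `PermanentNotInP` (stmt-PneNP-16143), line Sketch (xp-ladder) — stub `stub_guardFST`

The PRECISION GUARD as a finite-state transducer. For every `k` we build a deterministic finite-state
transducer `guardT k` over `{0,1}` which COPIES its input `w` and keeps the copy exactly when `w` parses as
`boolPair s (encodeNat i)` with `i < k` — i.e. as a doubled first component, the separator `01`, and then a
tail lying in the finite set `tails k = {encodeNat i | i < k}` — and otherwise outputs the empty word, which
is not a member of the crux's language `PermBits` (every member is a `boolPair`, of length `≥ 2`). Hence the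
preimage of `PermBits` under `(guardT k).eval` is the fixed-precision rung `PermLowBits k` (`PermBits` with
the guard `i < k`), and `|(guardT k).eval w| ≤ |w|`: this is the registered stub `stub_guardFST` of the
lead's skeleton `Cruxes/PermanentNotInP/Lines/Sketch.lean`, used there with the generic preimage lemma
(`stub_preimageFST`) to decide every rung with ONE exponent.

States: `Option Bool ⊕ Option (tailPrefixes k)` — phase A (`inl`: at a pair boundary / first bit of a pair
read) and phase B (`inr`: the tail read so far, as long as it is a prefix of some admissible tail; `none` =
dead). References: folklore (Mealy machines, Hopcroft–Ullman 1979 §2.7); the tree's `Transducers.lean`.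
-/

set_option linter.dupNamespace false

noncomputable section

namespace Summit.PneNP.PneNP.Theorems.XpLadder

open Literature.Computability.Complexity Computability

/-! ### The finite data: admissible tails and their prefixes -/

/-- The admissible tails at precision `k`: the binary numerals `encodeNat i`, `i < k`. [folklore] -/
def tails (k : ℕ) : Finset (List Bool) :=
  (Finset.range k).image encodeNat

/-- All prefixes of admissible tails (the live states of phase B). [folklore] -/
def tailPrefixes (k : ℕ) : Finset (List Bool) :=
  (tails k).biUnion fun t => t.inits.toFinset

/-- Membership in `tails k`. [folklore] -/
theorem mem_tails {k : ℕ} {t : List Bool} : t ∈ tails k ↔ ∃ i < k, encodeNat i = t := by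
  simp [tails]

/-- A prefix of an admissible tail is a live phase-B state. [folklore] -/
theorem prefix_mem_tailPrefixes {k : ℕ} {t p : List Bool} (ht : t ∈ tails k) (hp : p <+: t) :
    p ∈ tailPrefixes k := by
  simp only [tailPrefixes, Finset.mem_biUnion, List.mem_toFinset, List.mem_inits]
  exact ⟨t, ht, hp⟩

/-! ### The transducer -/

/-- States of the guard transducer: phase A (`inl none` = pair boundary, `inl (some b)` = first bit `b`
of a pair read) and phase B (`inr (some p)` = tail `p` read so far, still a prefix of an admissible tail;
`inr none` = dead). [folklore] -/
abbrev GState (k : ℕ) : Type :=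
  Option Bool ⊕ Option (tailPrefixes k)

/-- The phase-B start state: the empty tail if it is live (i.e. `k ≥ 1`), else dead. [folklore] -/
def startB (k : ℕ) : Option (tailPrefixes k) :=
  if h : ([] : List Bool) ∈ tailPrefixes k then some ⟨[], h⟩ else none

/-- Phase-B transition on the live states: extend the tail by the symbol read if the result is still a
prefix of an admissible tail, else die. [folklore] -/
def extendB (k : ℕ) (p : tailPrefixes k) (a : Bool) : Option (tailPrefixes k) :=
  if h : p.1 ++ [a] ∈ tailPrefixes k then some ⟨p.1 ++ [a], h⟩ else none

/-- The next state of the guard transducer. [folklore] -/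
def gnext (k : ℕ) : GState k → Bool → GState k
  | Sum.inl none, a => Sum.inl (some a)
  | Sum.inl (some b), a => if a = b then Sum.inl none else if b = false then Sum.inr (startB k) else Sum.inr none
  | Sum.inr none, _ => Sum.inr none
  | Sum.inr (some p), a => Sum.inr (extendB k p a)

/-- The guard transducer at precision `k`: copy every symbol; at the end keep the copy iff the final state
is a complete admissible tail. [folklore] -/
def guardT (k : ℕ) : FST (GState k) Bool Bool where
  init := Sum.inl none
  step s a := (gnext k s a, [a])
  front _ := []
  keep s := match s with
    | Sum.inr (some p) => decide (p.1 ∈ tails k)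
    | _ => false

/-- The acceptance bit of the guard: `keep` of the final state. [folklore] -/
def accept (k : ℕ) (w : List Bool) : Bool :=
  (guardT k).keep ((guardT k).run (Sum.inl none) w).1

/-! ### Runs -/

/-- The step of the guard transducer: move by `gnext`, emit the symbol read. [folklore] -/
@[simp] theorem guardT_step (k : ℕ) (s : GState k) (a : Bool) :
    (guardT k).step s a = (gnext k s a, [a]) := rfl

/-- `gnext` at a pair boundary: remember the first bit of the pair. [folklore] -/
@[simp] theorem gnext_boundary (k : ℕ) (a : Bool) : gnext k (Sum.inl none) a = Sum.inl (some a) := rfl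

/-- `gnext` on a doubled pair `bb`: back to the pair boundary. [folklore] -/
@[simp] theorem gnext_pair (k : ℕ) (b : Bool) : gnext k (Sum.inl (some b)) b = Sum.inl none := by
  simp [gnext]

/-- `gnext` on the separator `01`: enter phase B in its start state. [folklore] -/
@[simp] theorem gnext_sep (k : ℕ) : gnext k (Sum.inl (some false)) true = Sum.inr (startB k) := by
  simp [gnext]

/-- `gnext` on the dead state. [folklore] -/
@[simp] theorem gnext_dead (k : ℕ) (a : Bool) : gnext k (Sum.inr none) a = Sum.inr none := rfl

/-- `gnext` on a live phase-B state. [folklore] -/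
@[simp] theorem gnext_live (k : ℕ) (p : tailPrefixes k) (a : Bool) :
    gnext k (Sum.inr (some p)) a = Sum.inr (extendB k p a) := rfl

/-- The transducer copies its input: the emitted body is the word read. [folklore] -/
theorem run_snd (k : ℕ) (s : GState k) (w : List Bool) : ((guardT k).run s w).2 = w := by
  induction w generalizing s with
  | nil => rfl
  | cons a w ih => simp [FST.run_cons, ih]

/-- One step of a run (first component). [folklore] -/
theorem run_fst_cons (k : ℕ) (s : GState k) (a : Bool) (w : List Bool) :
    ((guardT k).run s (a :: w)).1 = ((guardT k).run (gnext k s a) w).1 := by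
  simp [FST.run_cons]

/-- A run on a concatenation (first component). [folklore] -/
theorem run_fst_append (k : ℕ) (s : GState k) (l₁ l₂ : List Bool) :
    ((guardT k).run s (l₁ ++ l₂)).1 = ((guardT k).run ((guardT k).run s l₁).1 l₂).1 := by
  rw [FST.run_append]

/-- The transduction: the input itself if accepted, else the empty word. [folklore] -/
theorem eval_eq (k : ℕ) (w : List Bool) : (guardT k).eval w = if accept k w then w else [] := by
  simp only [FST.eval, accept, run_snd]
  rfl

/-- The transduction does not increase length. [folklore] -/
theorem length_eval_le (k : ℕ) (w : List Bool) : ((guardT k).eval w).length ≤ w.length := by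
  rw [eval_eq]
  split <;> simp

/-- Phase A on a doubled word returns to the pair boundary. [folklore] -/
theorem run_dup (k : ℕ) (s : List Bool) :
    ((guardT k).run (Sum.inl none) (s.flatMap fun b => [b, b])).1 = Sum.inl none := by
  induction s with
  | nil => rfl
  | cons b s ih =>
    rw [List.flatMap_cons, run_fst_append]
    have h2 : ((guardT k).run (Sum.inl none) [b, b]).1 = Sum.inl none := by
      simp
    rw [h2, ih]

/-- Phase A then the separator `01`: the run enters phase B in its start state. [folklore] -/
theorem run_boolPair (k : ℕ) (s t : List Bool) :
    ((guardT k).run (Sum.inl none) (boolPair s t)).1 = ((guardT k).run (Sum.inr (startB k)) t).1 := by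
  rw [boolPair, List.append_assoc, run_fst_append, run_dup, run_fst_append]
  have h2 : ((guardT k).run (Sum.inl none) [false, true]).1 = Sum.inr (startB k) := by
    simp
  rw [h2]

/-- The dead state is absorbing. [folklore] -/
theorem run_dead (k : ℕ) (t : List Bool) : ((guardT k).run (Sum.inr none) t).1 = Sum.inr none := by
  induction t with
  | nil => rfl
  | cons a t ih => rw [run_fst_cons]; exact ih

/-- Phase B, soundness: a live final state records exactly the tail read. [folklore] -/
theorem run_live_sound (k : ℕ) (t : List Bool) :
    ∀ (p q : tailPrefixes k), ((guardT k).run (Sum.inr (some p)) t).1 = Sum.inr (some q) → q.1 = p.1 ++ t := by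
  induction t with
  | nil =>
    intro p q h
    have : (Sum.inr (some p) : GState k) = Sum.inr (some q) := h
    simp only [Sum.inr.injEq, Option.some.injEq] at this
    simp [this]
  | cons a t ih =>
    intro p q h
    rw [run_fst_cons, gnext_live] at h
    unfold extendB at h
    split_ifs at h with hlive
    · have := ih _ _ h
      simpa using this
    · rw [run_dead] at h
      exact absurd h (by simp)

/-- Phase B, completeness: if every prefix of `p ++ t` extending `p` is live, the run on `t` from `p` ends
live, recording `p ++ t`. [folklore] -/
theorem run_live_complete (k : ℕ) (t : List Bool) :
    ∀ (p : tailPrefixes k), (∀ j, p.1 ++ t.take j ∈ tailPrefixes k) →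
      ∃ q : tailPrefixes k, ((guardT k).run (Sum.inr (some p)) t).1 = Sum.inr (some q) ∧ q.1 = p.1 ++ t := by
  induction t with
  | nil => intro p _; exact ⟨p, rfl, by simp⟩
  | cons a t ih =>
    intro p hp
    have h1 : p.1 ++ [a] ∈ tailPrefixes k := by simpa using hp 1
    have hp' : ∀ j, (p.1 ++ [a]) ++ t.take j ∈ tailPrefixes k := fun j => by
      simpa [List.append_assoc] using hp (j + 1)
    obtain ⟨q, hq, hq'⟩ := ih ⟨p.1 ++ [a], h1⟩ hp'
    refine ⟨q, ?_, by simpa [List.append_assoc] using hq'⟩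
    rw [run_fst_cons, gnext_live]
    unfold extendB
    rw [dif_pos h1]
    exact hq

/-- **Acceptance is exactly tail-admissibility** on well-formed pairs. [folklore] -/
theorem accept_boolPair (k : ℕ) (s t : List Bool) : accept k (boolPair s t) = true ↔ t ∈ tails k := by
  unfold accept
  rw [show (guardT k).run (Sum.inl none) (boolPair s t) = (guardT k).run (guardT k).init (boolPair s t) from rfl]
  have hrun := run_boolPair k s t
  simp only [show (guardT k).init = Sum.inl none from rfl] at *
  rw [hrun]
  by_cases h0 : ([] : List Bool) ∈ tailPrefixes k
  · have hs : startB k = some ⟨[], h0⟩ := by simp [startB, h0]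
    rw [hs]
    constructor
    · intro hacc
      -- the final state is live, with a complete tail
      generalize hf : ((guardT k).run (Sum.inr (some ⟨[], h0⟩)) t).1 = f at hacc
      match f, hf, hacc with
      | Sum.inr (some q), hf, hacc =>
        have hq : q.1 = t := by simpa using run_live_sound k t ⟨[], h0⟩ q hf
        simpa [guardT, hq] using hacc
      | Sum.inr none, _, hacc => simp [guardT] at hacc
      | Sum.inl _, _, hacc => simp [guardT] at hacc
    · intro ht
      obtain ⟨q, hq, hq'⟩ := run_live_complete k t ⟨[], h0⟩
        (fun j => by simpa using prefix_mem_tailPrefixes ht (t.take_prefix j))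
      rw [hq]
      simp only [List.nil_append] at hq'
      simp [guardT, hq', ht]
  · have hs : startB k = none := by simp [startB, h0]
    rw [hs, run_dead]
    constructor
    · intro h; simp [guardT] at h
    · intro ht; exact absurd (prefix_mem_tailPrefixes ht t.nil_prefix) h0

/-! ### The stub -/

/-- **Stub `stub_guardFST` of line Sketch (crux `PermanentNotInP`, stmt-PneNP-16143).** For every precision
`k` a finite-state transducer over `{0,1}` whose transduction does not increase length and pulls the crux's
language `PermBits` back to the fixed-precision rung `PermLowBits k` (the same set-builder with the guard
`i < k`): the guard transducer `guardT k` (copy the input; keep it iff it is `boolPair s (encodeNat i)` with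
`i < k`, else output `ε ∉ PermBits`). [folklore] -/
theorem stub_guardFST :
    ∀ k : ℕ, ∃ (σ : Type) (_ : Fintype σ) (T : Literature.Computability.Complexity.FST σ Bool Bool),
      (∀ w : List Bool, (T.eval w).length ≤ w.length) ∧
      ∀ w : List Bool,
        (T.eval w ∈ ({w | ∃ (n : ℕ) (s : List Bool) (i : ℕ), s.length = n * n ∧ w = Literature.Computability.Complexity.boolPair s (Computability.encodeNat i) ∧ Nat.testBit (Matrix.permanent (Matrix.of fun a b : Fin n => if s.getD ((b : ℕ) + n * (a : ℕ)) false then (1 : ℕ) else 0)) i = true} : Language Bool)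
          ↔ w ∈ ({w | ∃ (n : ℕ) (s : List Bool) (i : ℕ), i < k ∧ s.length = n * n ∧ w = Literature.Computability.Complexity.boolPair s (Computability.encodeNat i) ∧ Nat.testBit (Matrix.permanent (Matrix.of fun a b : Fin n => if s.getD ((b : ℕ) + n * (a : ℕ)) false then (1 : ℕ) else 0)) i = true} : Language Bool)) := by
  intro k
  refine ⟨GState k, inferInstance, guardT k, length_eval_le k, fun w => ?_⟩
  simp only [Set.mem_setOf_eq, eval_eq]
  constructor
  · intro h
    by_cases hacc : accept k w = true
    · rw [if_pos hacc] at h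
      obtain ⟨n, s, i, hs, hw, hbit⟩ := h
      refine ⟨n, s, i, ?_, hs, hw, hbit⟩
      rw [hw, accept_boolPair, mem_tails] at hacc
      obtain ⟨j, hj, hji⟩ := hacc
      have : j = i := by simpa using congr_arg decodeNat hji
      omega
    · rw [if_neg hacc] at h
      obtain ⟨n, s, i, -, hw, -⟩ := h
      have := congr_arg List.length hw
      simp only [List.length_nil, length_boolPair] at this
      omega
  · rintro ⟨n, s, i, hik, hs, hw, hbit⟩
    have hacc : accept k w = true := by
      rw [hw, accept_boolPair, mem_tails]
      exact ⟨i, hik, rfl⟩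
    rw [if_pos hacc]
    exact ⟨n, s, i, hs, hw, hbit⟩

end Summit.PneNP.PneNP.Theorems.XpLadder

end
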